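import Literature.Dynamics.SymbolicDynamics.DistortionCurves
import Literature.Dynamics.SymbolicDynamics.DistortionSFT
import Literature.Dynamics.SymbolicDynamics.StrongIrreducibility
import HarnessLib

/-!
# Gluing in the distortion subshift: symbols along the curves

The symbol layer of the gluing construction for `d_A(Y)` (Gangloff–Sablik Props. 31–32). Given
an admissible `↓`-set (the skeleton built in `DistortionGlueGap.lean` / `DistortionGlueLevel.lean`)
and a configuration `x`, `fill hs x` writes `x` along the curves of the skeleton; it lies in
`d_A(Y)` iff `x ∈ Y` (`fill_mem_distortion`). Curve coordinates of cells (`coordOf`, inverse to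
`curvePt`) are transported from a configuration to any skeleton with the same `↓`-cells on a
large box around the base cell (`succ_nxt_transport`, from the locality theorem `curve_agree` of
`DistortionSFT.lean` applied to skeletons). The outcome is the abstract core of the gluing
(`glue_of_skeleton`): a skeleton agreeing with `z₁` on a box around `⟦0,n-1⟧²`, with `z₂ (· - u)`
on the translated box, in which the base cells of the two boxes differ by the curve coordinates
`(u.1, V)`, together with ONE `y ∈ Y` carrying the pseudo-projection blocks of `z₁` and `z₂` at
offset `(u.1, V)`, glue the `n`-blocks of `z₁` and `z₂` at offset `u` inside `d_A(Y)`; and the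
two concrete instances `core_gap` (second block far above) and `core_level` (second block level,
far to the right), where `V = V₀ ∓ k` is adjustable by the number `k` of extra lines.

## References

* S. Gangloff, M. Sablik, *Quantified block gluing for multidimensional subshifts of finite type:
  aperiodicity and entropy*, J. Anal. Math. 144 (2021), §5.4.2, Props. 31–32 (arXiv:1706.01627).
-/

namespace Literature.Dynamics.SymbolicDynamics.Distortion

open _root_.SymbolicDynamics.FullShift
open Literature.Dynamics.SymbolicDynamics (square mem_square IsShiftInvariant)

variable {A B : Type*}

/-! ### Curve coordinates of a cell -/

section Coord

variable {s : ℤ × ℤ → Option B} (hs : IsDelta s)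

/-- `curvePt i ·` is injective. [cite: GangloffSablik2021, §5.4.1 (arXiv numbering)] -/
theorem curvePt_right_injective {i k k' : ℤ} (h : curvePt hs i k = curvePt hs i k') : k = k' := by
  unfold curvePt at h
  exact nxtPerm_zpow_injective hs (base hs) ((succPerm hs ^ i).injective h)

/-- **The curve coordinates of a `→`-cell**: the `(i, k)` with `curvePt i k = c`.
[cite: GangloffSablik2021, §5.4.1 (arXiv numbering)] -/
noncomputable def coordOf (c : RC s) : ℤ × ℤ :=
  (c.1.1, Classical.choose (exists_curvePt_eq hs c))

/-- [cite: GangloffSablik2021, §5.4.1 (arXiv numbering)] -/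
theorem curvePt_coordOf (c : RC s) : curvePt hs (coordOf hs c).1 (coordOf hs c).2 = c :=
  Classical.choose_spec (exists_curvePt_eq hs c)

/-- [cite: GangloffSablik2021, §5.4.1 (arXiv numbering)] -/
theorem coordOf_curvePt (i k : ℤ) : coordOf hs (curvePt hs i k) = (i, k) := by
  have h := curvePt_coordOf hs (curvePt hs i k)
  have h1 : (coordOf hs (curvePt hs i k)).1 = i := curvePt_col hs i k
  rw [h1] at h
  exact Prod.ext h1 (curvePt_right_injective hs h)

/-- Moving `a` columns along the curves and `b` curves up adds `(a, b)` to the coordinates.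
[cite: GangloffSablik2021, §5.4.1 (arXiv numbering)] -/
theorem coordOf_succ_nxt (c : RC s) (a b : ℤ) :
    coordOf hs ((succPerm hs ^ a) ((nxtPerm hs ^ b) c)) = coordOf hs c + (a, b) := by
  conv_lhs => rw [← curvePt_coordOf hs c]
  rw [← curvePt_add_right, ← curvePt_add_left, coordOf_curvePt]
  refine Prod.ext ?_ ?_
  · show a + (coordOf hs c).1 = (coordOf hs c + (a, b)).1
    rw [Prod.fst_add, add_comm]
  · show (coordOf hs c).2 + b = (coordOf hs c + (a, b)).2
    rw [Prod.snd_add]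

end Coord

/-! ### Writing a configuration along the curves of a skeleton -/

section Fill

variable {s : ℤ × ℤ → Option B} (hs : IsDelta s) (x : ℤ × ℤ → A)

/-- **`fill hs x`**: `↓` on the `↓`-cells of `s`, and on the `→`-cell with curve coordinates
`(i, k)` the symbol `x (i, k)`. [cite: GangloffSablik2021, §5.4.2 (arXiv numbering)] -/
noncomputable def fill : ℤ × ℤ → Option A :=
  fun c => if h : s c = none then none else some (x (coordOf hs ⟨c, h⟩))

/-- [cite: GangloffSablik2021, §5.4.2 (arXiv numbering)] -/
theorem fill_eq_none_iff {c : ℤ × ℤ} : fill hs x c = none ↔ s c = none := by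
  unfold fill
  split_ifs with h <;> simp [h]

/-- [cite: GangloffSablik2021, §5.4.2 (arXiv numbering)] -/
theorem fill_apply_of_ne {c : ℤ × ℤ} (h : s c ≠ none) : fill hs x c = some (x (coordOf hs ⟨c, h⟩)) := by
  unfold fill
  rw [dif_neg h]

/-- [cite: GangloffSablik2021, §5.4.2 (arXiv numbering)] -/
theorem transfer_fill (c : ℤ × ℤ) : s c = none ↔ fill hs x c = none :=
  (fill_eq_none_iff hs x).symm

/-- [cite: GangloffSablik2021, §5.4.2 (arXiv numbering)] -/
theorem isDelta_fill : IsDelta (fill hs x) :=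
  hs.transfer (transfer_fill hs x)

/-- **The pseudo-projection of `fill hs x` is `x`.** [cite: GangloffSablik2021, §5.4.2 (arXiv numbering)] -/
theorem isProj_fill : IsProj (isDelta_fill hs x) x := by
  intro i k
  rw [curvePt_transfer (transfer_fill hs x) hs (isDelta_fill hs x) i k, castRC_val,
    fill_apply_of_ne hs x (curvePt hs i k).2]
  congr 2
  exact coordOf_curvePt hs i k

/-- **`fill hs x ∈ d_A(Y)` when `x ∈ Y`.** [cite: GangloffSablik2021, §5.4.2 (arXiv numbering)] -/
theorem fill_mem_distortion {Y : Set (ℤ × ℤ → A)} (hx : x ∈ Y) : fill hs x ∈ distortion Y :=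
  ⟨isDelta_fill hs x, x, hx, isProj_fill hs x⟩

end Fill

/-! ### Transport of curve coordinates to a skeleton -/

/-- **Transport**: if the `↓`-cells of `z` on the box of radius `R` around the `→`-cell `c`
are, translated to `c'`, those of the admissible set `N` around the `→`-cell `c'` of its
skeleton, then `S^a N^b (c')` sits, relative to `c'`, where `S^a N^b (c)` sits relative to `c`
(`|a| + 2|b| + 1 ≤ R`). [cite: GangloffSablik2021, §5.4.2 (arXiv numbering), Prop. 31] -/
theorem succ_nxt_transport {z : ℤ × ℤ → Option A} (hz : IsDelta z) {N : Set (ℤ × ℤ)}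
    (hN : IsDeltaSet N) (c : RC z) (c' : RC (skel N)) (R : ℤ)
    (hag : ∀ p : ℤ × ℤ, |p.1 - c.1.1| ≤ R → |p.2 - c.1.2| ≤ R → (z p = none ↔ p - c.1 + c'.1 ∈ N))
    (a b : ℤ) (hR : |a| + 2 * |b| + 1 ≤ R) :
    ((succPerm (isDelta_skel_iff.mpr hN) ^ a) ((nxtPerm (isDelta_skel_iff.mpr hN) ^ b) c')).1 =
      ((succPerm hz ^ a) ((nxtPerm hz ^ b) c)).1 - c.1 + c'.1 := by
  -- pass to the skeleton of `z`
  have hT := skel_noneSet_transfer z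
  have hZ : IsDelta (skel (noneSet z)) := hz.transfer hT
  have key := curve_agree hZ (isDelta_skel_iff.mpr hN) (castRC hT c) c' R ?_ a b hR
  · rw [key, nxtPerm_zpow_transfer hT hz hZ, succPerm_zpow_transfer hT hz hZ, castRC_val, castRC_val]
  intro p hp1 hp2
  rw [castRC_val] at hp1 hp2 ⊢
  -- two skeleton values agree iff the memberships agree
  have h := hag p hp1 hp2
  rw [← mem_noneSet (z := z), ← skel_eq_none_iff (N := noneSet z), ← skel_eq_none_iff (N := N)] at h
  rcases h1 : skel (noneSet z) p with _ | ⟨⟨⟩⟩ <;> rcases h2 : skel N (p - c.1 + c'.1) with _ | ⟨⟨⟩⟩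
  · rfl
  · exact absurd (h.mp h1) (by rw [h2]; simp)
  · exact absurd (h.mpr h2) (by rw [h1]; simp)
  · rfl

/-- Each step to the next `→`-cell above moves up by at least one row. [cite: GangloffSablik2021, §5.4.1 (arXiv numbering)] -/
theorem row_add_le_nxtPerm_pow {z : ℤ × ℤ → Option A} (hz : IsDelta z) (e : RC z) (m : ℕ) :
    e.1.2 + m ≤ ((nxtPerm hz ^ m) e).1.2 := by
  induction m with
  | zero => simp
  | succ m ih =>
    rw [pow_succ', Equiv.Perm.mul_apply, nxtPerm_apply, Nat.cast_succ]
    rcases nxtFun_row hz ((nxtPerm hz ^ m) e) with h | h <;> omega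

/-- `|b|` is at most the row distance between `c` and `N^b (c)`. [cite: GangloffSablik2021, §5.4.1 (arXiv numbering)] -/
theorem abs_le_of_nxtPerm_zpow {z : ℤ × ℤ → Option A} (hz : IsDelta z) (c : RC z) (b : ℤ) :
    |b| ≤ |((nxtPerm hz ^ b) c).1.2 - c.1.2| := by
  rcases le_or_gt 0 b with hb | hb
  · obtain ⟨m, rfl⟩ := Int.eq_ofNat_of_zero_le hb
    rw [zpow_natCast]
    have := row_add_le_nxtPerm_pow hz c m
    rw [Nat.abs_cast, abs_of_nonneg (by omega)]
    omega
  · obtain ⟨m, hm⟩ : ∃ m : ℕ, b = -m := ⟨(-b).toNat, by omega⟩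
    subst hm
    rw [zpow_neg, zpow_natCast, Equiv.Perm.inv_def]
    have := row_add_le_nxtPerm_pow hz ((nxtPerm hz ^ m).symm c) m
    rw [Equiv.apply_symm_apply] at this
    rw [abs_neg, Nat.abs_cast, abs_of_nonpos (by omega)]
    omega

/-! ### The abstract core of the gluing -/

section Core

variable {Y : Set (ℤ × ℤ → A)} (hY : IsShiftInvariant Y) {n : ℕ} (hn : 2 ≤ n)

/-- The base row in column `0`: `0` if `(0,0)` is a `→`-cell, else `1`. [cite: GangloffSablik2021, §5.4.1 (arXiv numbering)] -/
noncomputable def baseRow (z : ℤ × ℤ → Option A) : ℤ :=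
  if z (0, 0) = none then 1 else 0

/-- [cite: GangloffSablik2021, §5.4.1 (arXiv numbering)] -/
theorem baseRow_mem (z : ℤ × ℤ → Option A) : baseRow z = 0 ∨ baseRow z = 1 := by
  unfold baseRow; split_ifs <;> simp

/-- [cite: GangloffSablik2021, §5.4.1 (arXiv numbering)] -/
theorem apply_baseRow_ne_none {z : ℤ × ℤ → Option A} (hz : IsDelta z) : z (0, baseRow z) ≠ none := by
  unfold baseRow
  split_ifs with h
  · have := hz.above_ne_none h
    rwa [zero_add] at this
  · exact h

/-- The base `→`-cell `(0, baseRow z)`. [cite: GangloffSablik2021, §5.4.1 (arXiv numbering)] -/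
noncomputable def baseCell {z : ℤ × ℤ → Option A} (hz : IsDelta z) : RC z :=
  ⟨(0, baseRow z), apply_baseRow_ne_none hz⟩

/-- [cite: GangloffSablik2021, §5.4.1 (arXiv numbering)] -/
@[simp] theorem baseCell_val {z : ℤ × ℤ → Option A} (hz : IsDelta z) : (baseCell hz).1 = (0, baseRow z) :=
  rfl

/-- Every `→`-cell of the square `⟦0, n-1⟧²` is `S^a N^b` of the base cell with `0 ≤ a < n` and
`|b| < 2n`. [cite: GangloffSablik2021, §5.4.1 (arXiv numbering)] -/
theorem exists_small_coords {z : ℤ × ℤ → Option A} (hz : IsDelta z) (e : RC z)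
    (he : e.1 ∈ square n) :
    ∃ a b : ℤ, (succPerm hz ^ a) ((nxtPerm hz ^ b) (baseCell hz)) = e ∧ 0 ≤ a ∧ a < n ∧ |b| < 2 * n := by
  rw [mem_square] at he
  obtain ⟨m, hm⟩ : ∃ m : ℕ, (m : ℤ) = e.1.1 := ⟨e.1.1.toNat, by omega⟩
  obtain ⟨p, hp⟩ : ∃ p, p = (succPerm hz ^ m) (baseCell hz) := ⟨_, rfl⟩
  obtain ⟨h1, h2, h3⟩ := succPerm_pow_row_bounds hz (baseCell hz) m
  rw [← hp] at h1 h2 h3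
  simp only [baseCell_val] at h1 h2 h3
  obtain ⟨b, hb⟩ := exists_nxtPerm_zpow_eq hz p e (by rw [h1, zero_add, hm])
  have hbabs := abs_le_of_nxtPerm_zpow hz p b
  rw [hb] at hbabs
  rcases baseRow_mem z with h0 | h0 <;> rw [h0] at h2 h3
  all_goals
    refine ⟨m, b, ?_, by omega, by omega, ?_⟩
    · have hc : Commute (succPerm hz ^ (m : ℤ)) (nxtPerm hz ^ b) :=
        (commute_succPerm_nxtPerm hz).zpow_zpow m b
      rw [← Equiv.Perm.mul_apply, hc.eq, Equiv.Perm.mul_apply, zpow_natCast, ← hp, hb]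
    · have : |e.1.2 - p.1.2| < 2 * n := by rw [abs_lt]; constructor <;> omega
      omega

include hY hn in
/-- **The abstract core of the gluing.** A skeleton `N` agreeing with the `↓`-cells of `z₁` on
the box `⟦-(5n+1), 6n⟧²`, with those of `z₂` on its translate by `u`, in which the base cell of
the second box is `S^{u.1} N^{V}` of the base cell of the first, and one `y ∈ Y` carrying the
pseudo-projection of `z₁` around its base coordinates and that of `z₂` at offset `(u.1, V)`, give
a configuration of `d_A(Y)` with the `n`-block of `z₁` at the origin and that of `z₂` at `u`.
[cite: GangloffSablik2021, §5.4.2 (arXiv numbering), Props. 31–32] -/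
theorem glue_of_skeleton {z₁ z₂ : ℤ × ℤ → Option A} (hz₁ : IsDelta z₁) (hz₂ : IsDelta z₂)
    {N : Set (ℤ × ℤ)} (hN : IsDeltaSet N) (u : ℤ × ℤ) (V : ℤ)
    (hag₁ : ∀ p : ℤ × ℤ, -(5 * n + 1 : ℤ) ≤ p.1 → p.1 ≤ 6 * n → -(5 * n + 1 : ℤ) ≤ p.2 → p.2 ≤ 6 * n →
      (p ∈ N ↔ z₁ p = none))
    (hag₂ : ∀ p : ℤ × ℤ, -(5 * n + 1 : ℤ) ≤ p.1 → p.1 ≤ 6 * n → -(5 * n + 1 : ℤ) ≤ p.2 → p.2 ≤ 6 * n →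
      (u + p ∈ N ↔ z₂ p = none))
    (h₁ : skel N (0, baseRow z₁) ≠ none) (h₂ : skel N (u.1, u.2 + baseRow z₂) ≠ none)
    (hV : (succPerm (isDelta_skel_iff.mpr hN) ^ u.1)
      ((nxtPerm (isDelta_skel_iff.mpr hN) ^ V) ⟨(0, baseRow z₁), h₁⟩) = ⟨(u.1, u.2 + baseRow z₂), h₂⟩)
    {y : ℤ × ℤ → A} (hy : y ∈ Y)
    (hy₁ : ∀ v : ℤ × ℤ, |v.1| ≤ n → |v.2| ≤ 2 * n → y v = proj hz₁ (coordOf hz₁ (baseCell hz₁) + v))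
    (hy₂ : ∀ v : ℤ × ℤ, |v.1| ≤ n → |v.2| ≤ 2 * n →
      y ((u.1, V) + v) = proj hz₂ (coordOf hz₂ (baseCell hz₂) + v)) :
    ∃ z ∈ distortion Y, (∀ s ∈ square n, z s = z₁ s) ∧ ∀ s ∈ square n, z (u + s) = z₂ s := by
  set hs : IsDelta (skel N) := isDelta_skel_iff.mpr hN
  set c₁ : RC (skel N) := ⟨(0, baseRow z₁), h₁⟩ with hc₁
  set c₂ : RC (skel N) := ⟨(u.1, u.2 + baseRow z₂), h₂⟩ with hc₂
  set q := coordOf hs c₁ with hq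
  have hq₂ : coordOf hs c₂ = q + (u.1, V) := by rw [← hV, coordOf_succ_nxt]
  -- the symbols: `y`, re-indexed so that the base cell `c₁` reads `y 0`
  set x : ℤ × ℤ → A := shift (-q) y with hx
  have hxY : x ∈ Y := hY.shift_mem (-q) hy
  have hxv : ∀ v, x v = y (v - q) := fun v => by rw [hx, shift_apply, neg_add_eq_sub]
  refine ⟨fill hs x, fill_mem_distortion hs x hxY, fun s hsq => ?_, fun s hsq => ?_⟩
  · -- agreement at the origin
    have hsq' := hsq
    rw [mem_square] at hsq'
    by_cases hnone : z₁ s = none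
    · rw [hnone, fill_eq_none_iff, skel_eq_none_iff]
      exact (hag₁ s (by omega) (by omega) (by omega) (by omega)).mpr hnone
    · obtain ⟨a, b, hab, ha0, han, hb⟩ := exists_small_coords hz₁ ⟨s, hnone⟩ hsq
      -- transport the relative coordinates `(a, b)` to the skeleton
      have hpos := succ_nxt_transport hz₁ hN (baseCell hz₁) c₁ (5 * n + 1) ?_ a b
        (by rw [abs_of_nonneg ha0]; omega)
      · rw [hab, baseCell_val] at hpos
        simp only [hc₁] at hpos
        have hpos' : ((succPerm hs ^ a) ((nxtPerm hs ^ b) c₁)).1 = s := by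
          rw [hpos]; ext <;> simp
        have hsome : skel N s ≠ none := by rw [← hpos']; exact ((succPerm hs ^ a) ((nxtPerm hs ^ b) c₁)).2
        rw [fill_apply_of_ne hs x hsome, hxv]
        have hcoord : coordOf hs ⟨s, hsome⟩ = q + (a, b) := by
          rw [show (⟨s, hsome⟩ : RC (skel N)) = (succPerm hs ^ a) ((nxtPerm hs ^ b) c₁) from
            Subtype.ext hpos'.symm, coordOf_succ_nxt]
        rw [hcoord, add_sub_cancel_left, hy₁ (a, b) (by simp only; rw [abs_of_nonneg ha0]; omega)
          (by simp only; omega), ← coordOf_succ_nxt, hab]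
        have := isProj_proj hz₁ (coordOf hz₁ ⟨s, hnone⟩).1 (coordOf hz₁ ⟨s, hnone⟩).2
        rw [curvePt_coordOf] at this
        exact this.symm
      · intro p hp1 hp2
        simp only [baseCell_val, hc₁] at hp1 hp2 ⊢
        rw [show p - ((0 : ℤ), baseRow z₁) + (0, baseRow z₁) = p by abel]
        rw [abs_le] at hp1 hp2
        rcases baseRow_mem z₁ with h0 | h0 <;> rw [h0] at hp2 <;>
          exact ((hag₁ p (by omega) (by omega) (by omega) (by omega))).symm
  · -- agreement at `u`
    have hsq' := hsq
    rw [mem_square] at hsq'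
    by_cases hnone : z₂ s = none
    · rw [hnone, fill_eq_none_iff, skel_eq_none_iff]
      exact (hag₂ s (by omega) (by omega) (by omega) (by omega)).mpr hnone
    · obtain ⟨a, b, hab, ha0, han, hb⟩ := exists_small_coords hz₂ ⟨s, hnone⟩ hsq
      have hpos := succ_nxt_transport hz₂ hN (baseCell hz₂) c₂ (5 * n + 1) ?_ a b
        (by rw [abs_of_nonneg ha0]; omega)
      · rw [hab, baseCell_val] at hpos
        simp only [hc₂] at hpos
        have hpos' : ((succPerm hs ^ a) ((nxtPerm hs ^ b) c₂)).1 = u + s := by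
          rw [hpos]; ext <;> simp <;> ring
        have hsome : skel N (u + s) ≠ none := by
          rw [← hpos']; exact ((succPerm hs ^ a) ((nxtPerm hs ^ b) c₂)).2
        rw [fill_apply_of_ne hs x hsome, hxv]
        have hcoord : coordOf hs ⟨u + s, hsome⟩ = q + (u.1, V) + (a, b) := by
          rw [show (⟨u + s, hsome⟩ : RC (skel N)) = (succPerm hs ^ a) ((nxtPerm hs ^ b) c₂) from
            Subtype.ext hpos'.symm, coordOf_succ_nxt, hq₂]
        rw [hcoord, show q + (u.1, V) + (a, b) - q = (u.1, V) + (a, b) by abel,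
          hy₂ (a, b) (by simp only; rw [abs_of_nonneg ha0]; omega) (by simp only; omega),
          ← coordOf_succ_nxt, hab]
        have := isProj_proj hz₂ (coordOf hz₂ ⟨s, hnone⟩).1 (coordOf hz₂ ⟨s, hnone⟩).2
        rw [curvePt_coordOf] at this
        exact this.symm
      · intro p hp1 hp2
        simp only [baseCell_val, hc₂] at hp1 hp2 ⊢
        rw [show p - ((0 : ℤ), baseRow z₂) + (u.1, u.2 + baseRow z₂) = u + p by
          ext <;> simp <;> ring]
        rw [abs_le] at hp1 hp2
        rcases baseRow_mem z₂ with h0 | h0 <;> rw [h0] at hp2 <;>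
          exact ((hag₂ p (by omega) (by omega) (by omega) (by omega))).symm

end Core

end Literature.Dynamics.SymbolicDynamics.Distortion
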